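import Mathlib
import Summits.Ventures.PercRepro2.HCov
import Summits.Ventures.PercRepro2.A3Inactive
import Summits.Ventures.PercRepro2.EdgeCubic
import Summits.Ventures.PercRepro2.PendantA3Pins
import Summits.Ventures.PercRepro2.PendantA3Masses

/-!
# Row 2′CPOLAR at a PENDANT edge of `a₃`: the two Bernstein coefficients are (HCOV) at the two pins
plus the product of the `(o, u)` union-cluster covariance with the `(b, u)` BHK slack
(blind cell PercRepro2, p5 g15; `proofs/P5-OEDGE.md` §15–§16; p2 g13's (PM⁺), STATUS 06:20:54Z)

Let `a₃` be a LEAF attached to `u` by the edge `f` (`hf : ends f = s(a₃, u)`, `hleaf`). At `p[f↦0]` the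
leaf is isolated (`PD = Q`, `T = T′ = ∅` up to the pinned edge), at `p[f↦1]` it is identified with `u`
(`PD = PD_u`, `T = T_u`, `T′ = T′_u` — the worlds of the instance with `a₃ := u`), and every event
not mentioning `a₃` is free of `f` (`PendantRoot.free_connEvent`). Substituting the twenty-four
masses of `EdgeLine.B1` / `B2` (`prob_update_zero_PD_inter`, `prob_update_one_T_inter`, …) gives the
POLYNOMIAL identities (`B1Poly_pendant`, `B2Poly_pendant`; pure `ring`)

  `Q·D_u·B1 = Q·D_u·Gc₀ + D_u²·Gc₀ + Q²·Gc₁ + Q·(Qo·D_u − Q·Do_u)·(Ŝ − D_u·Qb)`,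
  `Q·D_u·B2 = Q·D_u·Gc₁ + D_u²·Gc₀ + Q²·Gc₁ + Q·(Qo·D_u − Q·Do_u)·(Ŝ − D_u·Qb)`,

with `Gc₀ = Gc p[f↦0]`, `Gc₁ = Gc p[f↦1]`, `Q = P(Q)`, `D_u = P(PD_u)`, `Do_u = P(PD_u, o ∈ U)`,
`Qo = P(Q, o ∈ U)`, `Qb = P(Q, b ∈ U)`, `Ŝ = Q·EQb3_u + gap·EQ3_u + Q·PDb_u`. The two factors are
`Qo·D_u − Q·Do_u = Q²·Cov_ν(U_o, U_u)` and `Ŝ − D_u·Qb = Q²·[Cov_ν(σ_b, σ_u) − Cov_ν(U_b, U_u)]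
= 2·[S(bL, uH) + S(bH, uL)] ≥ 0` (`slack_nonneg`, BHK06 Thm 1.4 twice through
`A3Inactive.bLoH_mul_Q_le` / `bHoL_mul_Q_le`). Hence **`B1_nonneg_pendant`**, **`B2_nonneg_pendant`**:
at a pendant edge of `a₃` with `P(PD_u) > 0`, (HCOV) at both pins and `Cov_ν(U_o, U_u) ≥ 0` give
`0 ≤ B1` and `0 ≤ B2` — row 2′CPOLAR at every pendant `a₃`-edge whose attachment vertex is
positively correlated with `o` in the union cluster; and **`HCov_pendant_of_cov_nonneg`**, the closure
«(HCOV) at `p[f↦0]` and `p[f↦1]` ⟹ (HCOV) at `p`» there. The paper reading: p2's `(PM⁺) = B + R`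
satisfies `(B + R)·μ(u ∉ U) = G_u·μ(u ∉ U) + Cov_μ(U_o, U_u)·[Cov_μ(σ_b, σ_u) − Cov_μ(U_b, U_u)]`, so it
can fail only where the union cluster is not positively associated for the pair `(o, u)`.
-/

namespace Summit.Ventures.PercRepro2

open UnionCluster CovForm PendantRoot

namespace PendantA3

/-! ## The Bernstein coefficients at a pendant edge -/

section Main

variable {V : Type*} {E : Type*} [Fintype V] [DecidableEq V] [Fintype E] [DecidableEq E]
  {R : Type*} [Field R] [LinearOrder R] [IsStrictOrderedRing R]

open EdgeLine

/-- **`0 ≤ B1` at a pendant edge of `a₃`** with attachment vertex `u`, given (HCOV) at both pins,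
`P(PD_u) > 0` and the union-cluster covariance `Cov_ν(U_o, U_u) ≥ 0` in its cleared form
`P(Q)·P(PD_u, o ∈ U) ≤ P(Q, o ∈ U)·P(PD_u)`. -/
theorem B1_nonneg_pendant (p : E → R) (hp : IsProbVec p) {ends : E → Sym2 V} {f : E}
    {o a₁ a₂ a₃ b u : V} (hf : ends f = s(a₃, u)) (hleaf : ∀ e, a₃ ∈ ends e → e = f)
    (h3u : a₃ ≠ u) (h13 : a₁ ≠ a₃) (h23 : a₂ ≠ a₃) (ho3 : o ≠ a₃) (hb3 : b ≠ a₃)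
    (hD : 0 < prob p (PDEvent ends a₁ a₂ u))
    (h₀ : HCov (Function.update p f 0) ends o a₁ a₂ a₃ b)
    (h₁ : HCov (Function.update p f 1) ends o a₁ a₂ a₃ b)
    (hcov : prob p (avoidAll ends a₂ {a₁}) * Do p ends o a₁ a₂ u ≤
      (prob p (avoidAll ends a₂ {a₁} ∩ connEvent ends a₁ o) +
        prob p (avoidAll ends a₂ {a₁} ∩ connEvent ends a₂ o)) * prob p (PDEvent ends a₁ a₂ u)) :
    0 ≤ B1 p ends o a₁ a₂ a₃ b f := by
  obtain ⟨hQ0, hD0, hDo0, hEQbo0, hEQb3_0, hEQb3o0, hEQo0, hEQ3_0, hEQ3o0, hPDb0, hPDbo0, hgap0⟩ :=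
    pins_zero_pendant p hf hleaf h3u h13 h23 ho3 hb3
  obtain ⟨hQ1, hD1, hDo1, hEQbo1, hEQb3_1, hEQb3o1, hEQo1, hEQ3_1, hEQ3o1, hPDb1, hPDbo1, hgap1⟩ :=
    pins_one_pendant p hf hleaf h3u h13 h23 ho3 hb3
  unfold HCov at h₀ h₁
  rw [Gc_eq_GcPoly] at h₀ h₁
  unfold B1
  rw [hQ0, hD0, hDo0, hEQbo0, hEQb3_0, hEQb3o0, hEQo0, hEQ3_0, hEQ3o0, hPDb0, hPDbo0, hgap0] at h₀
  rw [hQ1, hD1, hDo1, hEQbo1, hEQb3_1, hEQb3o1, hEQo1, hEQ3_1, hEQ3o1, hPDb1, hPDbo1, hgap1] at h₁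
  rw [hQ0, hD0, hDo0, hEQbo0, hEQb3_0, hEQb3o0, hEQo0, hEQ3_0, hEQ3o0, hPDb0, hPDbo0, hgap0, hQ1, hD1, hDo1, hEQbo1, hEQb3_1, hEQb3o1, hEQo1, hEQ3_1, hEQ3o1, hPDb1, hPDbo1, hgap1]
  have hQ : 0 ≤ prob p (avoidAll ends a₂ {a₁}) := prob_nonneg hp _
  have hQD : 0 < prob p (avoidAll ends a₂ {a₁}) * prob p (PDEvent ends a₁ a₂ u) := by
    have hle : prob p (PDEvent ends a₁ a₂ u) ≤ prob p (avoidAll ends a₂ {a₁}) := by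
      have := prob_PD_u_inter p ends a₁ a₂ u Set.univ
      simp only [Set.inter_univ] at this
      rw [this]
      linarith [prob_nonneg hp (avoidAll ends a₂ {a₁} ∩ connEvent ends a₂ u),
        prob_nonneg hp (avoidAll ends a₂ {a₁} ∩ connEvent ends a₁ u)]
    exact mul_pos (lt_of_lt_of_le hD hle) hD
  have hsl := slack_nonneg p hp ends a₁ a₂ u b
  have key := B1Poly_pendant (prob p (avoidAll ends a₂ {a₁})) (gap p ends a₁ a₂ b)
    (EQbo p ends o a₁ a₂ b) (EQo p ends o a₁ a₂)
    (prob p (avoidAll ends a₂ {a₁} ∩ connEvent ends a₁ o) +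
      prob p (avoidAll ends a₂ {a₁} ∩ connEvent ends a₂ o))
    (prob p (avoidAll ends a₂ {a₁} ∩ connEvent ends a₁ b) +
      prob p (avoidAll ends a₂ {a₁} ∩ connEvent ends a₂ b))
    (prob p (avoidAll ends a₂ {a₁} ∩ (connEvent ends a₁ o ∩ connEvent ends a₁ b)) +
      prob p (avoidAll ends a₂ {a₁} ∩ (connEvent ends a₂ o ∩ connEvent ends a₁ b)) +
      prob p (avoidAll ends a₂ {a₁} ∩ (connEvent ends a₁ o ∩ connEvent ends a₂ b)) +
      prob p (avoidAll ends a₂ {a₁} ∩ (connEvent ends a₂ o ∩ connEvent ends a₂ b)))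
    (prob p (PDEvent ends a₁ a₂ u)) (Do p ends o a₁ a₂ u) (EQb3 p ends a₁ a₂ u b)
    (EQb3o p ends o a₁ a₂ u b) (EQ3 p ends a₁ a₂ u) (EQ3o p ends o a₁ a₂ u)
    (PDb p ends a₁ a₂ u b) (PDbo p ends o a₁ a₂ u b)
  have hcov' : 0 ≤ (prob p (avoidAll ends a₂ {a₁} ∩ connEvent ends a₁ o) +
      prob p (avoidAll ends a₂ {a₁} ∩ connEvent ends a₂ o)) * prob p (PDEvent ends a₁ a₂ u) -
      prob p (avoidAll ends a₂ {a₁}) * Do p ends o a₁ a₂ u := by linarith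
  have hrhs : 0 ≤ prob p (avoidAll ends a₂ {a₁}) * prob p (PDEvent ends a₁ a₂ u) *
      B1Poly (prob p (avoidAll ends a₂ {a₁})) (prob p (avoidAll ends a₂ {a₁}))
        (prob p (avoidAll ends a₂ {a₁} ∩ connEvent ends a₁ o) +
          prob p (avoidAll ends a₂ {a₁} ∩ connEvent ends a₂ o))
        (EQbo p ends o a₁ a₂ b) 0 0 (EQo p ends o a₁ a₂) 0 0
        (prob p (avoidAll ends a₂ {a₁} ∩ connEvent ends a₁ b) +
          prob p (avoidAll ends a₂ {a₁} ∩ connEvent ends a₂ b))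
        (prob p (avoidAll ends a₂ {a₁} ∩ (connEvent ends a₁ o ∩ connEvent ends a₁ b)) +
          prob p (avoidAll ends a₂ {a₁} ∩ (connEvent ends a₂ o ∩ connEvent ends a₁ b)) +
          prob p (avoidAll ends a₂ {a₁} ∩ (connEvent ends a₁ o ∩ connEvent ends a₂ b)) +
          prob p (avoidAll ends a₂ {a₁} ∩ (connEvent ends a₂ o ∩ connEvent ends a₂ b)))
        (gap p ends a₁ a₂ b)
        (prob p (avoidAll ends a₂ {a₁})) (prob p (PDEvent ends a₁ a₂ u)) (Do p ends o a₁ a₂ u)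
        (EQbo p ends o a₁ a₂ b) (EQb3 p ends a₁ a₂ u b) (EQb3o p ends o a₁ a₂ u b)
        (EQo p ends o a₁ a₂) (EQ3 p ends a₁ a₂ u) (EQ3o p ends o a₁ a₂ u)
        (PDb p ends a₁ a₂ u b) (PDbo p ends o a₁ a₂ u b) (gap p ends a₁ a₂ b) := by
    rw [key]
    have t1 := mul_nonneg (mul_nonneg hQ hD.le) h₀
    have t2 := mul_nonneg (mul_nonneg hD.le hD.le) h₀
    have t3 := mul_nonneg (mul_nonneg hQ hQ) h₁
    have t4 := mul_nonneg (mul_nonneg hQ hcov') hsl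
    linarith
  exact (mul_nonneg_iff_of_pos_left hQD).1 hrhs

/-- **`0 ≤ B2` at a pendant edge of `a₃`** under the same hypotheses. -/
theorem B2_nonneg_pendant (p : E → R) (hp : IsProbVec p) {ends : E → Sym2 V} {f : E}
    {o a₁ a₂ a₃ b u : V} (hf : ends f = s(a₃, u)) (hleaf : ∀ e, a₃ ∈ ends e → e = f)
    (h3u : a₃ ≠ u) (h13 : a₁ ≠ a₃) (h23 : a₂ ≠ a₃) (ho3 : o ≠ a₃) (hb3 : b ≠ a₃)
    (hD : 0 < prob p (PDEvent ends a₁ a₂ u))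
    (h₀ : HCov (Function.update p f 0) ends o a₁ a₂ a₃ b)
    (h₁ : HCov (Function.update p f 1) ends o a₁ a₂ a₃ b)
    (hcov : prob p (avoidAll ends a₂ {a₁}) * Do p ends o a₁ a₂ u ≤
      (prob p (avoidAll ends a₂ {a₁} ∩ connEvent ends a₁ o) +
        prob p (avoidAll ends a₂ {a₁} ∩ connEvent ends a₂ o)) * prob p (PDEvent ends a₁ a₂ u)) :
    0 ≤ B2 p ends o a₁ a₂ a₃ b f := by
  obtain ⟨hQ0, hD0, hDo0, hEQbo0, hEQb3_0, hEQb3o0, hEQo0, hEQ3_0, hEQ3o0, hPDb0, hPDbo0, hgap0⟩ :=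
    pins_zero_pendant p hf hleaf h3u h13 h23 ho3 hb3
  obtain ⟨hQ1, hD1, hDo1, hEQbo1, hEQb3_1, hEQb3o1, hEQo1, hEQ3_1, hEQ3o1, hPDb1, hPDbo1, hgap1⟩ :=
    pins_one_pendant p hf hleaf h3u h13 h23 ho3 hb3
  unfold HCov at h₀ h₁
  rw [Gc_eq_GcPoly] at h₀ h₁
  unfold B2
  rw [hQ0, hD0, hDo0, hEQbo0, hEQb3_0, hEQb3o0, hEQo0, hEQ3_0, hEQ3o0, hPDb0, hPDbo0, hgap0] at h₀
  rw [hQ1, hD1, hDo1, hEQbo1, hEQb3_1, hEQb3o1, hEQo1, hEQ3_1, hEQ3o1, hPDb1, hPDbo1, hgap1] at h₁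
  rw [hQ0, hD0, hDo0, hEQbo0, hEQb3_0, hEQb3o0, hEQo0, hEQ3_0, hEQ3o0, hPDb0, hPDbo0, hgap0, hQ1, hD1, hDo1, hEQbo1, hEQb3_1, hEQb3o1, hEQo1, hEQ3_1, hEQ3o1, hPDb1, hPDbo1, hgap1]
  have hQ : 0 ≤ prob p (avoidAll ends a₂ {a₁}) := prob_nonneg hp _
  have hQD : 0 < prob p (avoidAll ends a₂ {a₁}) * prob p (PDEvent ends a₁ a₂ u) := by
    have hle : prob p (PDEvent ends a₁ a₂ u) ≤ prob p (avoidAll ends a₂ {a₁}) := by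
      have := prob_PD_u_inter p ends a₁ a₂ u Set.univ
      simp only [Set.inter_univ] at this
      rw [this]
      linarith [prob_nonneg hp (avoidAll ends a₂ {a₁} ∩ connEvent ends a₂ u),
        prob_nonneg hp (avoidAll ends a₂ {a₁} ∩ connEvent ends a₁ u)]
    exact mul_pos (lt_of_lt_of_le hD hle) hD
  have hsl := slack_nonneg p hp ends a₁ a₂ u b
  have key := B2Poly_pendant (prob p (avoidAll ends a₂ {a₁})) (gap p ends a₁ a₂ b)
    (EQbo p ends o a₁ a₂ b) (EQo p ends o a₁ a₂)
    (prob p (avoidAll ends a₂ {a₁} ∩ connEvent ends a₁ o) +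
      prob p (avoidAll ends a₂ {a₁} ∩ connEvent ends a₂ o))
    (prob p (avoidAll ends a₂ {a₁} ∩ connEvent ends a₁ b) +
      prob p (avoidAll ends a₂ {a₁} ∩ connEvent ends a₂ b))
    (prob p (avoidAll ends a₂ {a₁} ∩ (connEvent ends a₁ o ∩ connEvent ends a₁ b)) +
      prob p (avoidAll ends a₂ {a₁} ∩ (connEvent ends a₂ o ∩ connEvent ends a₁ b)) +
      prob p (avoidAll ends a₂ {a₁} ∩ (connEvent ends a₁ o ∩ connEvent ends a₂ b)) +
      prob p (avoidAll ends a₂ {a₁} ∩ (connEvent ends a₂ o ∩ connEvent ends a₂ b)))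
    (prob p (PDEvent ends a₁ a₂ u)) (Do p ends o a₁ a₂ u) (EQb3 p ends a₁ a₂ u b)
    (EQb3o p ends o a₁ a₂ u b) (EQ3 p ends a₁ a₂ u) (EQ3o p ends o a₁ a₂ u)
    (PDb p ends a₁ a₂ u b) (PDbo p ends o a₁ a₂ u b)
  have hcov' : 0 ≤ (prob p (avoidAll ends a₂ {a₁} ∩ connEvent ends a₁ o) +
      prob p (avoidAll ends a₂ {a₁} ∩ connEvent ends a₂ o)) * prob p (PDEvent ends a₁ a₂ u) -
      prob p (avoidAll ends a₂ {a₁}) * Do p ends o a₁ a₂ u := by linarith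
  have hrhs : 0 ≤ prob p (avoidAll ends a₂ {a₁}) * prob p (PDEvent ends a₁ a₂ u) *
      B2Poly (prob p (avoidAll ends a₂ {a₁})) (prob p (avoidAll ends a₂ {a₁}))
        (prob p (avoidAll ends a₂ {a₁} ∩ connEvent ends a₁ o) +
          prob p (avoidAll ends a₂ {a₁} ∩ connEvent ends a₂ o))
        (EQbo p ends o a₁ a₂ b) 0 0 (EQo p ends o a₁ a₂) 0 0
        (prob p (avoidAll ends a₂ {a₁} ∩ connEvent ends a₁ b) +
          prob p (avoidAll ends a₂ {a₁} ∩ connEvent ends a₂ b))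
        (prob p (avoidAll ends a₂ {a₁} ∩ (connEvent ends a₁ o ∩ connEvent ends a₁ b)) +
          prob p (avoidAll ends a₂ {a₁} ∩ (connEvent ends a₂ o ∩ connEvent ends a₁ b)) +
          prob p (avoidAll ends a₂ {a₁} ∩ (connEvent ends a₁ o ∩ connEvent ends a₂ b)) +
          prob p (avoidAll ends a₂ {a₁} ∩ (connEvent ends a₂ o ∩ connEvent ends a₂ b)))
        (gap p ends a₁ a₂ b)
        (prob p (avoidAll ends a₂ {a₁})) (prob p (PDEvent ends a₁ a₂ u)) (Do p ends o a₁ a₂ u)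
        (EQbo p ends o a₁ a₂ b) (EQb3 p ends a₁ a₂ u b) (EQb3o p ends o a₁ a₂ u b)
        (EQo p ends o a₁ a₂) (EQ3 p ends a₁ a₂ u) (EQ3o p ends o a₁ a₂ u)
        (PDb p ends a₁ a₂ u b) (PDbo p ends o a₁ a₂ u b) (gap p ends a₁ a₂ b) := by
    rw [key]
    have t1 := mul_nonneg (mul_nonneg hQ hD.le) h₁
    have t2 := mul_nonneg (mul_nonneg hD.le hD.le) h₀
    have t3 := mul_nonneg (mul_nonneg hQ hQ) h₁
    have t4 := mul_nonneg (mul_nonneg hQ hcov') hsl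
    linarith
  exact (mul_nonneg_iff_of_pos_left hQD).1 hrhs

/-- **The pendant closure of (HCOV)**: at a pendant edge `f` of `a₃` with attachment vertex `u`,
(HCOV) at `p[f↦0]` and at `p[f↦1]`, `P(PD_u) > 0` and `Cov_ν(U_o, U_u) ≥ 0` give (HCOV) at `p`
(row 2′CPOLAR at the pendant `a₃`-edges, through `EdgeLine.HCov_of_update_zero_of_bern`). -/
theorem HCov_pendant_of_cov_nonneg (p : E → R) (hp : IsProbVec p) {ends : E → Sym2 V} {f : E}
    {o a₁ a₂ a₃ b u : V} (hf : ends f = s(a₃, u)) (hleaf : ∀ e, a₃ ∈ ends e → e = f)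
    (h3u : a₃ ≠ u) (h13 : a₁ ≠ a₃) (h23 : a₂ ≠ a₃) (ho3 : o ≠ a₃) (hb3 : b ≠ a₃)
    (hD : 0 < prob p (PDEvent ends a₁ a₂ u))
    (h₀ : HCov (Function.update p f 0) ends o a₁ a₂ a₃ b)
    (h₁ : HCov (Function.update p f 1) ends o a₁ a₂ a₃ b)
    (hcov : prob p (avoidAll ends a₂ {a₁}) * Do p ends o a₁ a₂ u ≤
      (prob p (avoidAll ends a₂ {a₁} ∩ connEvent ends a₁ o) +
        prob p (avoidAll ends a₂ {a₁} ∩ connEvent ends a₂ o)) * prob p (PDEvent ends a₁ a₂ u)) :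
    HCov p ends o a₁ a₂ a₃ b :=
  HCov_of_update_zero_of_bern p hp ends o a₁ a₂ a₃ b f h₀ h₁
    (B1_nonneg_pendant p hp hf hleaf h3u h13 h23 ho3 hb3 hD h₀ h₁ hcov)
    (B2_nonneg_pendant p hp hf hleaf h3u h13 h23 ho3 hb3 hD h₀ h₁ hcov)

end Main

end PendantA3

end Summit.Ventures.PercRepro2
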